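import Mathlib
import Summits.ValiantsHypothesis.ValiantsHypothesis.Theorems.GrenetZeonTwoDimCoefficientsScalingIndexHdeg
import Summits.ValiantsHypothesis.ValiantsHypothesis.Theorems.GrenetZeonTwoDimCoefficientsScalingIndexShadowDet
import Summits.ValiantsHypothesis.ValiantsHypothesis.Theorems.GrenetZeonTwoDimCoefficientsScalingRankFactorization

/-!
# Crux `GrenetZeon.TwoDimCoefficients` (stmt-ValiantsHypothesis-8062), stub `stub_dualUnipotent`:
# scaling-closure — the TOP NUMERATOR of an index-`n` pencil and top companions beyond the rank (EIGHTEENTH-HAND.md, F2)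

For an index-`n` pencil `A = A₀(1 − N)` (`A₀P₀ = 1`, `N` linear forms, `Nⁿ = 0`, `det A = c ≠ 0`) and ANY affine `B′`
(in the numerator-perturbation argument `B′ = B + θ·C` is not a representation of `per_n`):

* `adjugate_eq_of_index` — `adj A = c·(Σ_{l<n} N^l)·P₀`.
* ★ `homogeneousComponent_adjugate_mul_of_index` — the top numerator is `[adj A·B′]_n = c·N^{n−1}·P₀·B′₁`
  (`B′₁` = linear part of `B′`), entrywise.
* `rank_topNumerator_le` — hence `rank (a·[adj A·B′]_n)(z) ≤ rank N(z)^{n−1}` at every point (`a ≠ 0`).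
* ★ `topCompanion_eq_zero_of_rank_lt` — `[D′_k]_{kn} = 0` for every `k > r` as soon as `rank N(z)^{n−1} ≤ r` for
  all `z` (✓ `topCompanion_eq` + ✓ `coeff_charpolyRev_eq_zero_of_forall_rank_lt`): the companions of `(A, B′)` vanish
  above the generic rank of `N^{n−1}`, uniformly in `B′`.

HONEST FRAMING: engine bookkeeping; the stub `DualUnipotentBound`, both cruxes (stmt-8062, stmt-24318) and `VP ≠ VNP`
remain open.

References: folklore.
-/

-- single-conjunct layout `Summits/ValiantsHypothesis/ValiantsHypothesis`: the duplicated namespace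
-- component is mandated by the tree.
set_option linter.dupNamespace false
set_option autoImplicit false

noncomputable section

namespace Summit.ValiantsHypothesis.ValiantsHypothesis.Theorems.GrenetZeonTwoDimCoefficients.ScalingClosure

open MvPolynomial Matrix
open Literature.Computability.AlgebraicComplexity
open Summit.ValiantsHypothesis.ValiantsHypothesis.Cruxes.TwoDimCoefficients.DimTwoCases

section TopNumerator

variable {σ : Type*} {m : ℕ}

/-- `adj A = c·(Σ_{l<n} N^l)·P₀` for an index-`n` pencil. [folklore] -/
theorem adjugate_eq_of_index {n : ℕ} (A₀ P₀ : Matrix (Fin m) (Fin m) ℂ) (hP₀ : A₀ * P₀ = 1)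
    (N : Matrix (Fin m) (Fin m) (MvPolynomial σ ℂ)) (hNn : N ^ n = 0) (A : Matrix (Fin m) (Fin m) (MvPolynomial σ ℂ))
    (hA : A = A₀.map MvPolynomial.C * (1 - N)) (c : ℂ) (hc : c ≠ 0) (hdet : A.det = MvPolynomial.C c) :
    A.adjugate = (MvPolynomial.C c : MvPolynomial σ ℂ) • ((∑ l ∈ Finset.range n, N ^ l) * P₀.map MvPolynomial.C) := by
  classical
  have hu : IsUnit A.det := by
    rw [hdet]
    exact (isUnit_iff_ne_zero.mpr hc).map MvPolynomial.C
  set Q : Matrix (Fin m) (Fin m) (MvPolynomial σ ℂ) :=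
    (∑ l ∈ Finset.range n, N ^ l) * P₀.map MvPolynomial.C with hQ
  have hAQ : A * Q = 1 := by
    rw [hA, hQ, Matrix.mul_assoc, ← Matrix.mul_assoc (1 - N), mul_neg_geom_sum, hNn, sub_zero,
      Matrix.one_mul, ← Matrix.map_mul, hP₀, Matrix.map_one _ (map_zero _) (map_one _)]
  rw [adjugate_eq_det_smul_inv A hu, Matrix.inv_eq_right_inv hAQ, hdet]

/-- ★ **Top numerator of an index-`n` pencil**: for any affine `B′`, `[adj A·B′]_n = c·N^{n−1}·P₀·B′₁` entrywise,
where `B′₁` is the matrix of linear parts of `B′` (`n ≥ 1`). [folklore] -/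
theorem homogeneousComponent_adjugate_mul_of_index {n : ℕ} (hn : 1 ≤ n) (A₀ P₀ : Matrix (Fin m) (Fin m) ℂ)
    (hP₀ : A₀ * P₀ = 1) (N : Matrix (Fin m) (Fin m) (MvPolynomial σ ℂ)) (hN : ∀ i j, (N i j).IsHomogeneous 1)
    (hNn : N ^ n = 0) (A : Matrix (Fin m) (Fin m) (MvPolynomial σ ℂ)) (hA : A = A₀.map MvPolynomial.C * (1 - N))
    (c : ℂ) (hc : c ≠ 0) (hdet : A.det = MvPolynomial.C c) (B' : Matrix (Fin m) (Fin m) (MvPolynomial σ ℂ))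
    (hB' : ∀ i j, (B' i j).totalDegree ≤ 1) (B1 : Matrix (Fin m) (Fin m) (MvPolynomial σ ℂ))
    (hB1 : ∀ a b, B1 a b = homogeneousComponent 1 (B' a b)) (i j : Fin m) :
    homogeneousComponent n ((A.adjugate * B') i j) =
      MvPolynomial.C c * (N ^ (n - 1) * ((P₀.map MvPolynomial.C : Matrix (Fin m) (Fin m) (MvPolynomial σ ℂ)) * B1)
        : Matrix (Fin m) (Fin m) (MvPolynomial σ ℂ)) i j := by
  classical
  set P₀' : Matrix (Fin m) (Fin m) (MvPolynomial σ ℂ) := P₀.map MvPolynomial.C with hP₀'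
  -- split `B′ = B′₀ + B′₁`
  set B0 : Matrix (Fin m) (Fin m) (MvPolynomial σ ℂ) := Matrix.of fun a b => MvPolynomial.C (coeff 0 (B' a b))
    with hB0
  have hsplit : B' = B0 + B1 := by
    apply Matrix.ext; intro a b
    rw [Matrix.add_apply, hB0, hB1, Matrix.of_apply]
    exact eq_C_add_homogeneousComponent_one (hB' a b)
  -- homogeneity of the pieces `N^l P₀ B′₀` (degree `l`) and `N^l P₀ B′₁` (degree `l + 1`)
  have hP₀B0 : ∀ a b, ((P₀' * B0) a b).IsHomogeneous 0 := by
    intro a b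
    rw [Matrix.mul_apply]
    refine IsHomogeneous.sum _ _ _ fun l _ => ?_
    rw [hP₀', Matrix.map_apply, hB0, Matrix.of_apply, ← map_mul]
    exact isHomogeneous_C _ _
  have hP₀B1 : ∀ a b, ((P₀' * B1) a b).IsHomogeneous 1 := by
    intro a b
    rw [Matrix.mul_apply]
    refine IsHomogeneous.sum _ _ _ fun l _ => ?_
    rw [hP₀', Matrix.map_apply, hB1]
    exact (homogeneousComponent_isHomogeneous 1 _).C_mul _
  have hpow := isHomogeneous_pow_apply hN
  have hT0 : ∀ l a b, ((N ^ l * (P₀' * B0)) a b).IsHomogeneous l := by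
    intro l a b
    rw [Matrix.mul_apply]
    refine IsHomogeneous.sum _ _ _ fun e _ => ?_
    simpa using (hpow l a e).mul (hP₀B0 e b)
  have hT1 : ∀ l a b, ((N ^ l * (P₀' * B1)) a b).IsHomogeneous (l + 1) := by
    intro l a b
    rw [Matrix.mul_apply]
    refine IsHomogeneous.sum _ _ _ fun e _ => ?_
    exact (hpow l a e).mul (hP₀B1 e b)
  -- expand `adj A · B′`
  have hexp : (A.adjugate * B') i j = MvPolynomial.C c *
      ((∑ l ∈ Finset.range n, (N ^ l * (P₀' * B0)) i j) + ∑ l ∈ Finset.range n, (N ^ l * (P₀' * B1)) i j) := by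
    rw [adjugate_eq_of_index A₀ P₀ hP₀ N hNn A hA c hc hdet, Matrix.smul_mul, Matrix.smul_apply, smul_eq_mul,
      ← hP₀', hsplit, Matrix.mul_add, Matrix.mul_assoc, Matrix.mul_assoc, Matrix.add_apply, Finset.sum_mul,
      Finset.sum_mul, Matrix.sum_apply, Matrix.sum_apply]
  rw [hexp, homogeneousComponent_C_mul, map_add, map_sum, map_sum]
  congr 1
  -- the `B′₀` part contributes nothing in degree `n` (degrees `l < n`), the `B′₁` part only `l = n − 1`
  have h0 : ∑ l ∈ Finset.range n, homogeneousComponent n ((N ^ l * (P₀' * B0)) i j) = 0 := by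
    refine Finset.sum_eq_zero fun l hl => ?_
    rw [homogeneousComponent_of_mem (hT0 l i j), if_neg]
    have := Finset.mem_range.mp hl; omega
  have h1 : ∑ l ∈ Finset.range n, homogeneousComponent n ((N ^ l * (P₀' * B1)) i j) =
      (N ^ (n - 1) * (P₀' * B1)) i j := by
    rw [Finset.sum_eq_single (n - 1)]
    · rw [homogeneousComponent_of_mem (hT1 (n - 1) i j), if_pos (by omega)]
    · intro l hl hne
      rw [homogeneousComponent_of_mem (hT1 l i j), if_neg]
      have := Finset.mem_range.mp hl; omega
    · intro h
      exact absurd (Finset.mem_range.mpr (by omega)) h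
  rw [h0, h1, zero_add]

/-- **Rank of the top numerator**: `rank (a·[adj A·B′]_n)(z) ≤ rank N(z)^{n−1}` at every point. [folklore] -/
theorem rank_topNumerator_le {n : ℕ} (hn : 1 ≤ n) (A₀ P₀ : Matrix (Fin m) (Fin m) ℂ)
    (hP₀ : A₀ * P₀ = 1) (N : Matrix (Fin m) (Fin m) (MvPolynomial σ ℂ)) (hN : ∀ i j, (N i j).IsHomogeneous 1)
    (hNn : N ^ n = 0) (A : Matrix (Fin m) (Fin m) (MvPolynomial σ ℂ)) (hA : A = A₀.map MvPolynomial.C * (1 - N))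
    (c : ℂ) (hc : c ≠ 0) (hdet : A.det = MvPolynomial.C c) (B' : Matrix (Fin m) (Fin m) (MvPolynomial σ ℂ))
    (hB' : ∀ i j, (B' i j).totalDegree ≤ 1)
    (Ptop : Matrix (Fin m) (Fin m) (MvPolynomial σ ℂ))
    (htop : ∀ i j, Ptop i j = homogeneousComponent n ((A.adjugate * B') i j)) {a : ℂ} (ha : a ≠ 0) (z : σ → ℂ) :
    (((MvPolynomial.C a : MvPolynomial σ ℂ) • Ptop).map (eval z)).rank ≤ (((N.map (eval z)) ^ (n - 1))).rank := by
  classical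
  set B1 : Matrix (Fin m) (Fin m) (MvPolynomial σ ℂ) := Matrix.of fun a b => homogeneousComponent 1 (B' a b) with hB1
  set P₀' : Matrix (Fin m) (Fin m) (MvPolynomial σ ℂ) := P₀.map MvPolynomial.C with hP₀'
  have hP : (MvPolynomial.C a : MvPolynomial σ ℂ) • Ptop = (MvPolynomial.C (a * c) : MvPolynomial σ ℂ) •
      (N ^ (n - 1) * (P₀' * B1)) := by
    apply Matrix.ext; intro i j
    rw [Matrix.smul_apply, htop, homogeneousComponent_adjugate_mul_of_index hn A₀ P₀ hP₀ N hN hNn A hA c hc hdet B' hB'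
      B1 (fun a b => rfl), Matrix.smul_apply, smul_eq_mul, smul_eq_mul, map_mul, ← hP₀']
    ring
  rw [hP]
  have hmap : ((MvPolynomial.C (a * c) : MvPolynomial σ ℂ) • (N ^ (n - 1) * (P₀' * B1))).map (eval z) =
      (a * c) • ((N.map (eval z)) ^ (n - 1) * ((P₀' * B1).map (eval z))) := by
    rw [← Matrix.map_pow, ← Matrix.map_mul]
    apply Matrix.ext; intro i j
    simp only [Matrix.map_apply, Matrix.smul_apply, smul_eq_mul, map_mul, MvPolynomial.eval_C]
  rw [hmap, rank_smul_eq (mul_ne_zero ha hc)]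
  exact Matrix.rank_mul_le_left _ _

/-- ★ **Top companions vanish beyond the generic rank of `N^{n−1}`.**  If `rank N(z)^{n−1} ≤ r` for every `z`, then
for every affine `B′` and every `k > r`: `[D′_k]_{kn} = 0`, `D′_k = [X^k] det(X·B′ + A)`. [folklore] -/
theorem topCompanion_eq_zero_of_rank_lt {n : ℕ} (hn : 1 ≤ n) (A₀ P₀ : Matrix (Fin m) (Fin m) ℂ)
    (hP₀ : A₀ * P₀ = 1) (N : Matrix (Fin m) (Fin m) (MvPolynomial (Fin n × Fin n) ℂ))
    (hN : ∀ i j, (N i j).IsHomogeneous 1) (hNn : N ^ n = 0) (A : AffMat n m)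
    (hA : A = A₀.map MvPolynomial.C * (1 - N)) (c : ℂ) (hc : c ≠ 0) (hdet : A.det = MvPolynomial.C c)
    (B' : AffMat n m) (hB' : IsAffine B') {r : ℕ}
    (hr : ∀ z : Fin n × Fin n → ℂ, (((N.map (eval z)) ^ (n - 1))).rank ≤ r)
    (D : ℕ → MvPolynomial (Fin n × Fin n) ℂ)
    (hD : ∀ k, D k = (det ((Polynomial.X : Polynomial (MvPolynomial (Fin n × Fin n) ℂ)) •
      B'.map Polynomial.C + A.map Polynomial.C)).coeff k)
    {k : ℕ} (hk : r < k) : homogeneousComponent (k * n) (D k) = 0 := by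
  classical
  have hadj : ∀ i j, (A.adjugate i j).totalDegree ≤ n - 1 :=
    totalDegree_adjugate_le_of_index hn A₀ P₀ hP₀ N hN hNn A hA c hc hdet
  have hP : ∀ i j, ((A.adjugate * B') i j).totalDegree ≤ n := fun i j =>
    (totalDegree_adjugate_mul_le A B' (n - 1) hadj hB' i j).trans (by omega)
  set Ptop : AffMat n m := Matrix.of fun i j => homogeneousComponent n ((A.adjugate * B') i j) with hPtop
  rw [hD, topCompanion_eq A B' c hc hdet hP Ptop (fun i j => rfl) k]
  have hneg : -((MvPolynomial.C c⁻¹ : MvPolynomial (Fin n × Fin n) ℂ) • Ptop) =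
      (MvPolynomial.C (-c⁻¹) : MvPolynomial (Fin n × Fin n) ℂ) • Ptop := by
    apply Matrix.ext; intro i j
    rw [Matrix.neg_apply, Matrix.smul_apply, Matrix.smul_apply, smul_eq_mul, smul_eq_mul, map_neg, neg_mul]
  rw [hneg, coeff_charpolyRev_eq_zero_of_forall_rank_lt _ (fun z => ?_), mul_zero]
  exact (rank_topNumerator_le hn A₀ P₀ hP₀ N hN hNn A hA c hc hdet B' hB' Ptop (fun i j => rfl)
    (neg_ne_zero.mpr (inv_ne_zero hc)) z).trans_lt ((hr z).trans_lt hk)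

end TopNumerator

end Summit.ValiantsHypothesis.ValiantsHypothesis.Theorems.GrenetZeonTwoDimCoefficients.ScalingClosure

end
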